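/-
Lane (xiv-h) «MASS-AWARE CEILING» part 3/5 — MECHANICAL CARVE (rh-split-typer-3 g2, RULING #292 (c)) of zd-neg GEN-18
`HOME/rh-split-zd-neg/g18/tree/MassAwareSamplingCeiling.lean` sha16 60d461fef9600800 (1191 l): source lines 650–810 VERBATIM
(cut at the source's `###` section-doc seams); only this header, the imports, the namespace brackets and 1 insert-only one-line docstring(s) (gate `lint.docstring`, repair xivh-a) are added per part.
Nothing here bears on the truth of RH.
-/
import Summits.RiemannHypothesis.RiemannHypothesis.Theorems.Splittings.MassAwareSamplingCeilingB

/-!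
# Splittings — zd-neg GEN-18 «MASS-AWARE CEILING» (the node `MassAwareSamplingL L 2 θ` is FALSE for every `θ ≥ 2/5`), part 3/5
(source sections G18.3): the RINGED-PLANET configuration is admissible at width `δ₀ = (1−2t)p` for every window.
Full provenance, audit notes and the section map are in the source header (zd-neg g18, card `cards/SPLIT-zd-neg.md` GEN-18).

HONEST LABEL: «SPLITTING SEARCH over kernel-typed RH-EQUIVALENCES; a splitting A ∧ B ⟹ RH is CONDITIONAL bookkeeping
unless A and B are both proved; nothing here bears on the truth of RH.»
-/

set_option linter.dupNamespace false

noncomputable section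

open scoped Classical ComplexConjugate
open Set Filter Topology Complex MeasureTheory

namespace Summit.RiemannHypothesis.RiemannHypothesis.Theorems.Splittings.MassAwareSamplingCeiling

open Summit.RiemannHypothesis.RiemannHypothesis.Theorems.Splittings.BombieriTruncMassAware (Phi LocBand MassAwareSampling)

/-! ### G18.3 The RINGED-PLANET configuration is admissible at width `δ₀ = (1−2t)p` for EVERY window

Planets `p·j` (`|j| ≤ m`) of mass `(1−2t)pD` and, for each `i < q`, the two moons `p·j ± (i+1)tp/q` of mass `(tp/q)D`, as ONE
configuration indexed by `Fin ((2m+1) + (q(2m+1) + q(2m+1)))`; `κ ≡ 0`, `w₀ = 0`. -/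

/-- moon offsets `c_i = (i+1)·η/q`, `i < q` (`η = tp` = outer ring radius). -/
def moff (η : ℝ) (q : ℕ) (i : Fin q) : ℝ := (((i : ℕ) : ℝ) + 1) * (η / q)

/-- one signed moon family: index `(i, j) ↦ p·j + σ·c_i` through `finProdFinEquiv`. -/
def moonLam (p η σ : ℝ) (q m : ℕ) : Fin (q * (2 * m + 1)) → ℝ :=
  fun k ↦ latt p m (finProdFinEquiv.symm k).2 + σ * moff η q (finProdFinEquiv.symm k).1

/-- planets, then `+` moons, then `−` moons. -/
def ringLam (p η : ℝ) (q m : ℕ) : Fin ((2 * m + 1) + (q * (2 * m + 1) + q * (2 * m + 1))) → ℝ :=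
  Fin.append (latt p m) (Fin.append (moonLam p η 1 q m) (moonLam p η (-1) q m))

/-- their masses: `M` on the planets, `μ` on every moon. -/
def ringW (M μ : ℝ) (q m : ℕ) : Fin ((2 * m + 1) + (q * (2 * m + 1) + q * (2 * m + 1))) → ℝ :=
  Fin.append (fun _ : Fin (2 * m + 1) ↦ M) (Fin.append (fun _ : Fin (q * (2 * m + 1)) ↦ μ) (fun _ : Fin (q * (2 * m + 1)) ↦ μ))

/-- All ring weights `ringW M μ q m k` are positive when `M, μ > 0`. PURE. -/
theorem ringW_pos {M μ : ℝ} (hM : 0 < M) (hμ : 0 < μ) (q m : ℕ) : ∀ k, 0 < ringW M μ q m k := by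
  intro k
  induction k using Fin.addCases with
  | left i => rw [ringW, Fin.append_left]; exact hM
  | right i =>
    rw [ringW, Fin.append_right]
    induction i using Fin.addCases with
    | left j => rw [Fin.append_left]; exact hμ
    | right j => rw [Fin.append_right]; exact hμ

/-- BLOCK DECOMPOSITION of any sum over the ring configuration: planets + Σ_i Σ_j (moon⁺ + moon⁻). -/
theorem ring_sum (φ : ℝ → ℝ → ℝ) (p η M μ : ℝ) (q m : ℕ) :
    ∑ k, φ (ringLam p η q m k) (ringW M μ q m k)
      = ∑ j : Fin (2 * m + 1), φ (latt p m j) M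
        + ∑ i : Fin q, ∑ j : Fin (2 * m + 1), (φ (latt p m j + moff η q i) μ + φ (latt p m j - moff η q i) μ) := by
  rw [Fin.sum_univ_add]
  simp only [ringLam, ringW, Fin.append_left, Fin.append_right]
  rw [Fin.sum_univ_add (a := q * (2 * m + 1)) (b := q * (2 * m + 1))]
  simp only [Fin.append_left, Fin.append_right]
  have hblock : ∀ σ : ℝ, ∑ k : Fin (q * (2 * m + 1)), φ (moonLam p η σ q m k) μ
      = ∑ i : Fin q, ∑ j : Fin (2 * m + 1), φ (latt p m j + σ * moff η q i) μ := by
    intro σ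
    rw [← Fintype.sum_prod_type']
    exact Equiv.sum_comp finProdFinEquiv.symm (fun x : Fin q × Fin (2 * m + 1) ↦ φ (latt p m x.2 + σ * moff η q x.1) μ)
  rw [hblock 1, hblock (-1), ← Finset.sum_add_distrib]
  congr 1
  refine Finset.sum_congr rfl fun i _ ↦ ?_
  rw [← Finset.sum_add_distrib]
  refine Finset.sum_congr rfl fun j _ ↦ ?_
  rw [one_mul, neg_one_mul, ← sub_eq_add_neg]

/-- shifted exact window count: points `p·j + c` (`|c| ≤ 1`) in `(a, b] ⊆ [−Λ, Λ]`, `(Λ+1)/p < m+1`, weighted by `μ`. -/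
theorem sum_window_shift {p Λ a b c μ : ℝ} {m : ℕ} (hp : 0 < p) (hm : (Λ + 1) / p < (m : ℝ) + 1) (hc : |c| ≤ 1)
    (ha : -Λ ≤ a) (hab : a < b) (hb : b ≤ Λ) :
    (∑ j : Fin (2 * m + 1), if a < latt p m j + c ∧ latt p m j + c ≤ b then μ else 0)
      = μ * ((⌊(b - c) / p⌋ : ℝ) - (⌊(a - c) / p⌋ : ℝ)) := by
  have hc' := abs_le.mp hc
  have s : Finset.univ.filter (fun j ↦ a < latt p m j + c ∧ latt p m j + c ≤ b)
      = Finset.univ.filter (fun j ↦ a - c < latt p m j ∧ latt p m j ≤ b - c) := by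
    ext k
    simp only [Finset.mem_filter, Finset.mem_univ, true_and]
    constructor <;> rintro ⟨h1, h2⟩ <;> exact ⟨by linarith, by linarith⟩
  rw [sum_ite_const_eq, s]
  congr 1
  exact_mod_cast card_latt_window (Λ := Λ + 1) (a := a - c) (b := b - c) hp hm (by linarith) (by linarith) (by linarith)

/-- `Σ_{i : Fin q} g i = Σ_{i < q} g i` bookkeeping for the moon offsets. -/
theorem sum_fin_moff (t p : ℝ) (q : ℕ) (G : ℝ → ℝ) :
    ∑ i : Fin q, G ((((i : ℕ) : ℝ) + 1) * (t * p / q)) = ∑ i ∈ Finset.range q, G (((i : ℝ) + 1) * (t * p / q)) := by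
  rw [Fin.sum_univ_eq_sum_range (f := fun i : ℕ ↦ G (((i : ℝ) + 1) * (t * p / q)))]

/-- **The ringed planets are admissible.**  With `0 < t ≤ 1/3`, `tp ≤ 1`, `q ≥ 1`: planets `p·j` of mass `(1−2t)pD` and moons
`p·j ± (i+1)tp/q` of mass `(tp/q)D` (`|j| ≤ m`, `(Λ+1)/p < m+1`), `κ ≡ 0`, `w₀ = 0`, satisfy the band at width `δ` for every `δ ≥ (1−2t)p`
and EVERY window (no length cap used): `mass(a,b] − D(b−a) = D·p·(W(b/p) − W(a/p))` and `W ∈ [−(1−t), −t]` (`W_mem`). -/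
theorem band_rings {δ p t η D Λ : ℝ} {q m : ℕ} (hp : 0 < p) (ht0 : 0 < t) (ht3 : t ≤ 1 / 3) (hq : 0 < q) (hη : η = t * p)
    (hη1 : η ≤ 1) (hδ : (1 - 2 * t) * p ≤ δ) (hD : 0 < D) (hm : (Λ + 1) / p < (m : ℝ) + 1) {a b : ℝ} (ha : -Λ ≤ a)
    (hab : a < b) (hb : b ≤ Λ) :
    |(∑ k ∈ Finset.univ.filter (fun k ↦ a < ringLam p η q m k ∧ ringLam p η q m k ≤ b), ringW ((1 - 2 * t) * p * D) (η / q * D) q m k) +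
        (if a < 0 ∧ 0 ≤ b then (0 : ℝ) else 0) - D * (b - a)| ≤ δ * D := by
  have hqpos : (0 : ℝ) < q := by exact_mod_cast hq
  have hη0 : 0 < η := by rw [hη]; positivity
  simp only [ite_self, add_zero]
  rw [Finset.sum_filter, ring_sum (fun x w ↦ if a < x ∧ x ≤ b then w else 0)]
  -- planets
  have c1 : (∑ j : Fin (2 * m + 1), if a < latt p m j ∧ latt p m j ≤ b then (1 - 2 * t) * p * D else 0)
      = (1 - 2 * t) * p * D * ((⌊b / p⌋ : ℝ) - (⌊a / p⌋ : ℝ)) := by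
    rw [sum_ite_const_eq]
    congr 1
    exact_mod_cast card_latt_window (Λ := Λ + 1) hp hm (by linarith) hab (by linarith)
  -- moons: offsets `c_i ∈ (0, η] ⊆ (0, 1]`
  have hci : ∀ i : Fin q, 0 < moff η q i ∧ moff η q i ≤ η := by
    intro i
    have hi : ((i : ℕ) : ℝ) + 1 ≤ q := by exact_mod_cast i.isLt
    refine ⟨by unfold moff; positivity, ?_⟩
    unfold moff
    calc (((i : ℕ) : ℝ) + 1) * (η / q) ≤ q * (η / q) := mul_le_mul_of_nonneg_right hi (div_pos hη0 hqpos).le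
      _ = η := by field_simp
  have c2 : ∀ i : Fin q, (∑ j : Fin (2 * m + 1),
      ((if a < latt p m j + moff η q i ∧ latt p m j + moff η q i ≤ b then η / q * D else 0)
        + (if a < latt p m j - moff η q i ∧ latt p m j - moff η q i ≤ b then η / q * D else 0)))
      = η / q * D * (((⌊b / p - (((i : ℕ) : ℝ) + 1) * (t / q)⌋ : ℝ) + (⌊b / p + (((i : ℕ) : ℝ) + 1) * (t / q)⌋ : ℝ))
          - ((⌊a / p - (((i : ℕ) : ℝ) + 1) * (t / q)⌋ : ℝ) + (⌊a / p + (((i : ℕ) : ℝ) + 1) * (t / q)⌋ : ℝ))) := by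
    intro i
    obtain ⟨hc0, hcη⟩ := hci i
    rw [Finset.sum_add_distrib, sum_window_shift hp hm (abs_le.mpr ⟨by linarith, by linarith⟩) ha hab hb]
    have e2 : (∑ j : Fin (2 * m + 1), if a < latt p m j - moff η q i ∧ latt p m j - moff η q i ≤ b then η / q * D else 0)
        = ∑ j : Fin (2 * m + 1), if a < latt p m j + (-moff η q i) ∧ latt p m j + (-moff η q i) ≤ b then η / q * D else 0 := by
      simp only [← sub_eq_add_neg]
    rw [e2, sum_window_shift hp hm (abs_le.mpr ⟨by linarith, by linarith⟩) ha hab hb]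
    have ec : moff η q i / p = (((i : ℕ) : ℝ) + 1) * (t / q) := by
      unfold moff; rw [hη]; field_simp
    rw [sub_div b, sub_div a, sub_neg_eq_add, sub_neg_eq_add, add_div b, add_div a, ec]
    ring
  rw [c1, Finset.sum_congr rfl fun i _ ↦ c2 i, ← Finset.mul_sum, Finset.sum_sub_distrib]
  rw [Fin.sum_univ_eq_sum_range
        (f := fun i : ℕ ↦ ((⌊b / p - ((i : ℝ) + 1) * (t / q)⌋ : ℝ) + (⌊b / p + ((i : ℝ) + 1) * (t / q)⌋ : ℝ))),
      Fin.sum_univ_eq_sum_range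
        (f := fun i : ℕ ↦ ((⌊a / p - ((i : ℝ) + 1) * (t / q)⌋ : ℝ) + (⌊a / p + ((i : ℝ) + 1) * (t / q)⌋ : ℝ)))]
  have key : (1 - 2 * t) * p * D * ((⌊b / p⌋ : ℝ) - (⌊a / p⌋ : ℝ))
      + η / q * D * ((∑ i ∈ Finset.range q, (((⌊b / p - ((i : ℝ) + 1) * (t / q)⌋ : ℤ) : ℝ) + ((⌊b / p + ((i : ℝ) + 1) * (t / q)⌋ : ℤ) : ℝ)))
          - ∑ i ∈ Finset.range q, (((⌊a / p - ((i : ℝ) + 1) * (t / q)⌋ : ℤ) : ℝ) + ((⌊a / p + ((i : ℝ) + 1) * (t / q)⌋ : ℤ) : ℝ)))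
      - D * (b - a) = D * p * (W t q (b / p) - W t q (a / p)) := by
    unfold W
    generalize (∑ i ∈ Finset.range q, (((⌊b / p - ((i : ℝ) + 1) * (t / q)⌋ : ℤ) : ℝ) + ((⌊b / p + ((i : ℝ) + 1) * (t / q)⌋ : ℤ) : ℝ))) = SB
    generalize (∑ i ∈ Finset.range q, (((⌊a / p - ((i : ℝ) + 1) * (t / q)⌋ : ℤ) : ℝ) + ((⌊a / p + ((i : ℝ) + 1) * (t / q)⌋ : ℤ) : ℝ))) = SA
    generalize (⌊b / p⌋ : ℤ) = A₁
    generalize (⌊a / p⌋ : ℤ) = A₂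
    rw [hη]
    field_simp
    ring
  rw [key]
  have hWb := W_mem ht0 ht3 hq (b / p)
  have hWa := W_mem ht0 ht3 hq (a / p)
  have hd1 : W t q (b / p) - W t q (a / p) ≤ 1 - 2 * t := by linarith [hWb.2, hWa.1]
  have hd2 : -(1 - 2 * t) ≤ W t q (b / p) - W t q (a / p) := by linarith [hWb.1, hWa.2]
  have hDp : 0 ≤ D * p := by positivity
  have h3 := mul_le_mul_of_nonneg_left hd1 hDp
  have h4 := mul_le_mul_of_nonneg_left hd2 hDp
  have h5 : (1 - 2 * t) * p * D ≤ δ * D := mul_le_mul_of_nonneg_right hδ hD.le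
  rw [abs_le]
  constructor <;> nlinarith

/-- Every member of x-wuc G9b's capped family `LocBandL L` (any cap `L`) holds for the rings … -/
theorem locBandL_rings (Lcap : ℝ) {δ p t η D Λ : ℝ} {q m : ℕ} (hp : 0 < p) (ht0 : 0 < t) (ht3 : t ≤ 1 / 3) (hq : 0 < q)
    (hη : η = t * p) (hη1 : η ≤ 1) (hδ : (1 - 2 * t) * p ≤ δ) (hD : 0 < D) (hm : (Λ + 1) / p < (m : ℝ) + 1) :
    LocBandL Lcap δ D Λ (ringLam p η q m) (ringW ((1 - 2 * t) * p * D) (η / q * D) q m) 0 :=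
  fun _ _ ha hab hb _ ↦ band_rings hp ht0 ht3 hq hη hη1 hδ hD hm ha hab hb

/-- … so does the cap-4 band `LocBand` of the tree node … -/
theorem locBand_rings {δ p t η D Λ : ℝ} {q m : ℕ} (hp : 0 < p) (ht0 : 0 < t) (ht3 : t ≤ 1 / 3) (hq : 0 < q)
    (hη : η = t * p) (hη1 : η ≤ 1) (hδ : (1 - 2 * t) * p ≤ δ) (hD : 0 < D) (hm : (Λ + 1) / p < (m : ℝ) + 1) :
    LocBand δ D Λ (ringLam p η q m) (ringW ((1 - 2 * t) * p * D) (η / q * D) q m) 0 :=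
  fun _ _ ha hab hb _ ↦ band_rings hp ht0 ht3 hq hη hη1 hδ hD hm ha hab hb

/-- … and the ALL-WINDOWS band `LocBandAll`. -/
theorem locBandAll_rings {δ p t η D Λ : ℝ} {q m : ℕ} (hp : 0 < p) (ht0 : 0 < t) (ht3 : t ≤ 1 / 3) (hq : 0 < q)
    (hη : η = t * p) (hη1 : η ≤ 1) (hδ : (1 - 2 * t) * p ≤ δ) (hD : 0 < D) (hm : (Λ + 1) / p < (m : ℝ) + 1) :
    LocBandAll δ D Λ (ringLam p η q m) (ringW ((1 - 2 * t) * p * D) (η / q * D) q m) 0 :=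
  fun _ _ ha hab hb ↦ band_rings hp ht0 ht3 hq hη hη1 hδ hD hm ha hab hb



end Summit.RiemannHypothesis.RiemannHypothesis.Theorems.Splittings.MassAwareSamplingCeiling
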